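import Summits.AtomisticToContinuum.Crystallization.Theses.PalmUnimodularRigidity
import Summits.AtomisticToContinuum.Crystallization.Theses.PoissonBesselStacking
import Summits.AtomisticToContinuum.Crystallization.Theorems.LayeredLawsSelectHcp.Negative.RootedRedundant
import Summits.AtomisticToContinuum.Crystallization.Theorems.LayeredLawsSelectHcp.Negative.FccModel
import Literature.MathematicalPhysics.StatisticalMechanics.BarlowStackingEnergy

/-!
# Line `stacking-blind-coercivity-transfer` — checked skeleton for crux `LayeredLawsSelectHcp`
(item stmt-AtomisticToContinuum-9226, route `PalmUnimodularRigidity`, rank 3; crux-plan round 1)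

Crux (by name, concluded by `LayeredLawsSelectHcp_of` below; unbundled by the landed Negative lemma
`RootedRedundant.crux_iff_without_rooted`): every probability law `P` on rooted configurations of `ℝ³`
which is POINT-STATIONARY (Mecke), MINIMISING (`E_P[h] ≤ e*`) and LAYERED (a.s. all shells
`(1/100)`-close-packed and the point set globally bond-isomorphic to an ideal Barlow stacking) is a.s. an
exact rotated relaxed hcp crystal `count|A(hcpStacking a h)` with `e(hcp a h) = e*`.

## The line (idea card `Ideas/stacking-blind-coercivity-transfer.md` ≈ `kyp-bilayer-transfer-certificate`,
## merged by all three triagers; TRIAGE-r1-1/2/3: pass)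

STIFFNESS IS STACKING-BLIND, SELECTION IS SOFT.  Split the second variation of the Lennard-Jones energy of
the ideal own-word reference `barlowStacking a⋆ h⋆ s` (the sample's arbitrary Hägg word `s`, at the
hcp-optimal cell `(a⋆,h⋆) ≈ (0.9713, 0.7929)`) by LAYER DISTANCE: intra-slab pairs (same or adjacent
layer, range ≤ 6) + far pairs (layer distance 2…7, range ≤ 6) + tail.  The intra-slab part of EVERY word
is a chain `Σ_m q^{(s_m)}(u_m, u_{m+1})` of the two mirror-image bilayer forms `q^{(±1)}` (the proved
barrier `ShortRangeStackingBlindness_holds` read as a resource), so ONE quadratic storage functional `p`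
on single-layer fields with `q^{(σ)}(u,v) + p(u) − p(v) ≥ λ_T·s^{(σ)}(u,v)` for `σ = ±1` (a discrete
Kalman–Yakubovich–Popov / dissipation certificate: one Hermitian `P(k∥)` per in-plane Bloch vector, two
6×6 LMIs) certifies near-field coercivity UNIFORMLY IN THE WORD by telescoping (`stub_transferCertificate`,
λ_T = 3/2; numerics: common storage feasible with ZERO loss, threshold = hcp's own 3-D value ≈ 1.82 at
range 6, 1.92 at range 1.48, optimal storage `P(k) = iκ(k⊗e₃ − e₃⊗k)` — kit j012751 part A, j012726 §D;
the storage-free version `p ≡ 0` is FALSE: the free bilayer buckles at long waves, j008774/j010557).  The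
word-seeing far field only needs a word-free negative-stiffness BUDGET against the nearest-neighbour
stretch of the slabs it straddles, and a bound on its residual fault forces (`stub_farFieldBudget`,
Σ_k k·ν_k ≤ 7/10, numerics −0.25 for hcp / fcc / dhcp, j010557 [5D]; Σ_{k≥2}|∂_h J_k| ≤ 24|J₂|, numerics 16.7|J₂|).  Selection is the bounded shift-covariant Hägg CURRENT (`stub_haggCurrent`,
the Peierls count of 0737 in pointwise form, provable now from `LjRegistryDomination` 3063 =
`stub_ljRegistryDomination` BY NAME).  THE ENGINE (`stub_lawLevelEngine`, hardest) lifts these finite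
certificates to the law level: exact prestress split of every pair term about the own-word reference,
vanishing of the expected first variation (mass-transport additivity of mean labelled bond vectors + ZERO
STRESS of the relaxed cell; Young at fault-adjacent layers, slaving loss (2K+1)·F²/(2λ_⊥) ≈ 1e-8·(2K+1)
per cubic layer against the fault price |J₂|/2 ≈ 3.6e-5), near field by the storage certificate
telescoped IN EXPECTATION along the stationary layer chain (in-plane spectral measure, infrared cut-off,
layer averaging), far field by the budget (or the rotation-free cable tax), anharmonicity by secant
convexity of `V` on the tube, Hägg current telescoped the same way — output `MasterInequality`:
`e(hcp a⋆ h⋆) + c·t²·P(root's radius-4 cluster not t-close to a rotated hcp(a⋆,h⋆) cluster) ≤ E_P[h]`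
for every layered point-stationary probability law and every tolerance `t ∈ (0,1]`, with NO minimising
hypothesis.  The composition spends H3 exactly once: `E_P[h] ≤ e* ≤ e(hcp a⋆ h⋆)` (`eStar_le`) kills
every tolerance event, and `stub_rigidReadout` (compactness `t → 0`, Palm transfer "root a.s. ⇒ every
point a.s.", exact local rules for hcp) reads off `μ = count|A(hcpStacking a⋆ h⋆)` a.s.; the same
sandwich gives `e(hcp a⋆ h⋆) = e*`.

  S1 `stub_transferCertificate`  `TransferCertificate (3/2)` — THE LEVER (word-blind bilayer storage certificate).
  S2 `stub_farFieldBudget`       `FarFieldBudget (7/10) 24` — word-free far-field budgets (negative stiffness; fault forces).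
  S3 `stub_ljRegistryDomination` `PoissonBesselStacking.LjRegistryDomination` (stmt-3063) BY NAME.
  S4 `stub_haggCurrent`          `LjRegistryDomination → HaggCurrent` (Peierls count as a bounded covariant current).
  S5 `stub_lawLevelEngine`       `EngineClosure` = S1 → S2 → S3 → HaggCurrent → `MasterInequality` — HARDEST.
  S6 `stub_rigidReadout`         `RigidReadout` — null tolerance events ⇒ a.s. exact rotated hcp (no energy).

`composition` (sorry-free, no stub used) : S1 → S2 → S3 → S4 → S5 → S6 → the crux in the H1-free form of
`crux_iff_without_rooted`; `LayeredLawsSelectHcp_of : LayeredLawsSelectHcp` feeds the six registered stubs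
into it and concludes the crux BY NAME (obligation tags are gate-reserved, hence the hypothesis-free form).

## Disproof / Negative lemmas honoured (tree `Cruxes/LayeredLawsSelectHcp/Disproof.lean`, gen 1; landed
## `Theorems/LayeredLawsSelectHcp/Negative/*`, imported here)
* `FccModel.layeredLawsSelectHcp_false_without_energy` (H3 load-bearing; the fcc Palm law satisfies H1, H2,
  H4): no stub concludes hcp from H1/H2/H4 — S5's `MasterInequality` and S6 carry NO minimising hypothesis
  and do not conclude hcp; H3 enters once, in `composition`, at the sandwich `E_P[h] ≤ e* ≤ e(hcp a⋆ h⋆)`.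
  The fcc law is priced by S5 at `≥ c·t²` for every `t` at which its radius-4 cluster is not hcp-like —
  i.e. the line must and does deliver `e_fcc(a) > e(hcp a⋆ h⋆)` on `[9/10, 1]`, the negation of the
  hypothesis of the disprover's kill criterion `layeredLawsSelectHcp_false_of_fcc_rootEnergy_le`.
* `RootedRedundant.crux_iff_without_rooted` (H1 and `δ` are decoration): used verbatim — every stub is
  `δ`-free.
* `PeriodicEnergy.isRelaxedHcp_of_crux` / `AllStackings.isRelaxedHcp_of_crux_barlow` (the crux restricted to
  periodic polytypes is the ATTAINMENT form of Hägg selection): consistent — `MasterInequality` applied to the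
  Palm law of an ideal periodic polytype `Q` reads `e(hcp a⋆ h⋆) + c t²·(fraction of non-hcp-like motif
  points) ≤ e(Q)`.
* Mutation notes: `∃ A` kept (B-sites see `hcpStacking (−a) h = −hcp`, `IntendedModel.hcpStacking_sub_b_eq_neg`
  — S6 concludes `∃ A`, and `CloseToHcp` quantifies `∃ A`); `(a, h)` free in a box (relaxed `c/a ≠ √(8/3)`):
  `InBox` = `[0.970, 0.9725] × [0.792, 0.794]` ∋ `(a⋆, h⋆)` (numerics of three seats agree to 2e-5).
* No stub is an instance of a refuted statement (`ledger negatives`: 4146 single D5h shell, 3506 one-grain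
  gluing — deterministic finite-configuration statements outside the hypothesis class of 9226).
-/

noncomputable section

open scoped BigOperators ENNReal
open MeasureTheory Classical

namespace Summit.AtomisticToContinuum.Crystallization.Cruxes.LayeredLawsSelectHcp.StackingBlindCoercivityTransfer

open Literature.MathematicalPhysics.StatisticalMechanics
open Summit.AtomisticToContinuum.Crystallization.Theses.PalmUnimodularRigidity (LayeredLawsSelectHcp)
open Summit.AtomisticToContinuum.Crystallization.Theses.PoissonBesselStacking (LjRegistryDomination)
open Summit.AtomisticToContinuum.Crystallization.Theorems.ChargedEnergyGapNegative (eStar eStar_le)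
open Summit.AtomisticToContinuum.Crystallization.Theorems.LayeredLawsSelectHcp.Negative.DiracLaws
open Summit.AtomisticToContinuum.Crystallization.Theorems.LayeredLawsSelectHcp.Negative.RootedRedundant

/-- Euclidean 3-space. -/
local notation "E3" => EuclideanSpace ℝ (Fin 3)

/-! ## Vocabulary: the reference cell, pair forms, bilayer slabs, stackings -/

/-- **The reference box** `B₁ = [0.970, 0.9725] × [0.792, 0.794]` for the relaxed hcp cell `(a⋆, h⋆)`
(in-plane spacing, layer spacing) of `lennardJones = r⁻¹²/12 − r⁻⁶/6`: numerics `a⋆ = 0.97127…0.97129`,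
`h⋆ = 0.79293…0.79294` (kit j008774, j012726, j012659, j012751 — four independent codes); the box is ~100×
their spread and lies inside the box of `LjRegistryDomination` (3063) and inside the crux's shell scales
`[9/10, 1]`. Every certificate below is quantified over `B₁`; the engine LOCATES the minimiser of
`e(hcp ·,·)` inside it. -/
def InBox (a h : ℝ) : Prop :=
  97 / 100 ≤ a ∧ a ≤ 389 / 400 ∧ 99 / 125 ≤ h ∧ h ≤ 397 / 500

/-- **Prestressed pair-Hessian quadratic form** of the Lennard-Jones bond with reference vector `r`,
evaluated on the relative displacement `v`: `V''(|r|)·(r̂·v)² + (V'(|r|)/|r|)·(|v|² − (r̂·v)²)` — twice the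
second-order Taylor coefficient of `v ↦ V(|r + v|)` (longitudinal stiffness + transverse PRESTRESS term,
negative for the compressed first shell `V'(a⋆) < 0`, positive beyond `r = 1`). -/
def hessQ (r v : E3) : ℝ :=
  deriv (deriv lennardJones) ‖r‖ * (inner ℝ r v / ‖r‖) ^ 2 +
    deriv lennardJones ‖r‖ / ‖r‖ * (‖v‖ ^ 2 - (inner ℝ r v / ‖r‖) ^ 2)

/-- **Bond-stretch square** `(r̂·v)²` (linearised elongation of the bond `r` under relative displacement `v`). -/
def stretchQ (r v : E3) : ℝ :=
  (inner ℝ r v / ‖r‖) ^ 2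

/-- Generic **bond sum over ordered pairs** of a labelled reference configuration `X`: weights `w p q`
(encoding range / layer restrictions), pair density `φ (X p − X q) (u p − u q)`. A `finsum`; for a finitely
supported field `u` and weights of bounded range only finitely many terms are non-zero. -/
def bondSum {ι : Type*} (X : ι → E3) (w : ι → ι → ℝ) (φ : E3 → E3 → ℝ) (u : ι → E3) : ℝ :=
  ∑ᶠ pq : ι × ι, if pq.1 = pq.2 then 0 else w pq.1 pq.2 * φ (X pq.1 - X pq.2) (u pq.1 - u pq.2)

/-- **Oriented ideal bilayer slab**: layer `0` (letter offset `0`, height `0`) and layer `1` (letter offset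
`σ = ±1`, height `h`) of the triangular layers of spacing `a`; `layerVec a h δ k i j = i u + j v + δ w + k h e₃`.
A Barlow word IS a sequence of these two mirror-image slabs (`σ_m = s m`). -/
def slabPos (σ : ℤ) (a h : ℝ) (p : Fin 2 × ℤ × ℤ) : E3 :=
  layerVec a h (σ * (p.1 : ℤ)) (p.1 : ℤ) p.2.1 p.2.2

/-- Slab pair weight: in-layer pairs are shared between the two slabs containing the layer (`1/2`), cross
pairs belong to the slab (`1`) — so that slabs ASSEMBLE to the 3-D forms of any stacking. -/
def slabWeight {α : Type*} (p q : Fin 2 × α) : ℝ :=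
  if p.1 = q.1 then 1 / 2 else 1

/-- **Harmonic slab form** `q^{(σ)}(u)`: `Σ_{unordered intra-slab pairs, range ≤ 6} w · ½ (u_p − u_q)ᵀ H (u_p − u_q)`
(written over ordered pairs with the factor `1/4`). Normalisation of the idea card / kit j008774. -/
def slabForm (σ : ℤ) (a h : ℝ) (u : Fin 2 × ℤ × ℤ → E3) : ℝ :=
  bondSum (slabPos σ a h)
    (fun p q => if dist (slabPos σ a h p) (slabPos σ a h q) ≤ 6 then slabWeight p q / 4 else 0) hessQ u

/-- **Nearest-neighbour stretch form of the slab** `s^{(σ)}(u)`: ordered pairs at reference distance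
`≤ 11a/10` (six in-layer + three cross bonds per site), in-layer weight `1/2`. -/
def slabStretch (σ : ℤ) (a h : ℝ) (u : Fin 2 × ℤ × ℤ → E3) : ℝ :=
  bondSum (slabPos σ a h)
    (fun p q => if dist (slabPos σ a h p) (slabPos σ a h q) ≤ 11 / 10 * a then slabWeight p q else 0)
    stretchQ u

/-- **Quadratic storage functional** on single-layer fields, given by a translation-invariant kernel
`K : ℤ² → End(ℝ³)`: `p_K(v) = Σ_{x,y} ⟪v x, K(y − x) (v y)⟫` (finite for finitely supported `v`). In Bloch
variables one Hermitian matrix per in-plane wave vector; the numerically optimal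
common storage (`P(k∥) = Σ_d K(d) e^{ik·d}`) is the bending-moment transfer `P(k) = iκ (k ⊗ e₃ − e₃ ⊗ k)`, `κ ≈ 0.136` (kit j012751 A). -/
def storageQ (K : ℤ × ℤ → (E3 →ₗ[ℝ] E3)) (v : ℤ × ℤ → E3) : ℝ :=
  ∑ᶠ xy : (ℤ × ℤ) × (ℤ × ℤ), inner ℝ (v xy.1) (K (xy.2 - xy.1) (v xy.2))

/-- Labelled sites of the ideal Barlow stacking of word `s`: `(k, i, j) ↦ barlowPos a h s k i j`. -/
def stackPos (a h : ℝ) (s : ℤ → ℤ) (p : ℤ × ℤ × ℤ) : E3 :=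
  barlowPos a h s p.1 p.2.1 p.2.2

/-- **Stretch form of slab `m` inside the stacking** (layers `m`, `m+1`; same normalisation as
`slabStretch`, so that `Σ_m slabStretchS m` is the total nearest-neighbour stretch over ordered pairs). -/
def slabStretchS (a h : ℝ) (s : ℤ → ℤ) (m : ℤ) (u : ℤ × ℤ × ℤ → E3) : ℝ :=
  bondSum (stackPos a h s)
    (fun p q => if (p.1 = m ∨ p.1 = m + 1) ∧ (q.1 = m ∨ q.1 = m + 1) ∧
        dist (stackPos a h s p) (stackPos a h s q) ≤ 11 / 10 * a
      then (if p.1 = q.1 then 1 / 2 else 1) else 0)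
    stretchQ u

/-- **Far pair form** between layers `m` and `m + k` of the stacking (all pairs of reference distance `≤ 6`
with one end in each layer; harmonic, factor `1/4` over ordered pairs). Only these forms SEE the word. -/
def farPairForm (a h : ℝ) (s : ℤ → ℤ) (m : ℤ) (k : ℕ) (u : ℤ × ℤ × ℤ → E3) : ℝ :=
  bondSum (stackPos a h s)
    (fun p q => if ((p.1 = m ∧ q.1 = m + k) ∨ (p.1 = m + k ∧ q.1 = m)) ∧
        dist (stackPos a h s p) (stackPos a h s q) ≤ 6 then 1 / 4 else 0)
    hessQ u

/-! ## The statements of the line -/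

/-- **S1 — THE LEVER: word-blind bilayer transfer (storage) certificate**, constant `λ`. For every cell in
`B₁` there is ONE quadratic storage `p_K` on single-layer fields such that for BOTH slab orientations
`σ = ±1` and every finitely supported bilayer field `u`:
`λ · s^{(σ)}(u) ≤ q^{(σ)}(u) + p_K(u|layer 0) − p_K(u|layer 1)`.
Summed over the slabs of ANY Hägg word the storage telescopes away: near-field coercivity uniform in the
word. (`p ≡ 0` is refuted numerically — isolated bilayers buckle, `λ₀(k) ≈ −0.98|k|⁻²`; an ARBITRARY
non-quadratic `p` would make the statement equivalent to its goal (TRIAGE-r1-1/3) — the quadratic kernel is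
the genuine common-Lyapunov restriction, decidable per `k∥` by a 2-parameter LMI after the symmetry
reduction `P = −MPM`, `P = iA`, `A` real antisymmetric, `A₁₂ = 0` (TRIAGE-r1-1 (b), r1-2).) -/
def TransferCertificate (lam : ℝ) : Prop :=
  ∀ a h : ℝ, InBox a h →
    ∃ K : ℤ × ℤ → (E3 →ₗ[ℝ] E3), ∀ σ : ℤ, (σ = 1 ∨ σ = -1) →
      ∀ u : Fin 2 × ℤ × ℤ → E3, (Function.support u).Finite →
        lam * slabStretch σ a h u ≤
          slabForm σ a h u + storageQ K (fun ij => u (0, ij)) - storageQ K (fun ij => u (1, ij))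

/-- **S2 — word-free FAR-FIELD BUDGETS** (the word-SEEING part of the energy is never certified, only
budgeted; two finite families of lattice-sum estimates over `B₁`, two block types per layer distance —
aligned / non-aligned, `layerInteraction_eq_ite`).
(i) NEGATIVE STIFFNESS, total `ν₀`: per-layer-distance allowances `ν_k ≥ 0`, `k = 2…7` (reference distance
`≤ 6` forces layer distance `≤ 7` on `B₁`), `Σ_k k·ν_k ≤ ν₀`, such that for EVERY Hägg word, every layer `m`
and every finitely supported field on the stacking, the far pair form of layers `(m, m+k)` is `≥ −ν_k ×`
(nearest-neighbour stretch of the `k` slabs it straddles); each slab is straddled by `≤ Σ_k k` such pairs,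
so the assembled far field is `≥ −ν₀ ×` total stretch, word-uniformly (numerics: −0.25 for hcp/fcc/dhcp at
range 6, kit j010557 [5D]; dominant term the `k = 2` breathing softness `Φ''(2h⋆) ≈ −0.38`).
(ii) FAULT FORCES, constant `φ₀`: `h ↦ J_k(a,h)` is differentiable and `Σ_{k≥2} |∂_h J_k| ≤ φ₀·|J₂|` — the
residual (vertical, layer-uniform) force on a site of an ideal stacking at the hcp-optimal uniform spacing is
`≤ 2 Σ_{k≥2} |∂_h J_k|/k`, non-zero only where the alignment patterns above and below differ; this is the
input of the engine's Young / slaving step (numerics `Σ_{k≥2}|∂_h J_k| = 1.21e-3 = 16.7 |J₂|`, kit j012726 §C,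
j012659 (D); the typed bound of card stress-jump-young-hagg-density). -/
def FarFieldBudget (ν₀ φ₀ : ℝ) : Prop :=
  (∃ ν : ℕ → ℝ, (∀ k, 0 ≤ ν k) ∧ (∑ k ∈ Finset.Icc (2 : ℕ) 7, (k : ℝ) * ν k) ≤ ν₀ ∧
    ∀ a h : ℝ, InBox a h → ∀ s : ℤ → ℤ, IsHaggSeq s → ∀ m : ℤ, ∀ k ∈ Finset.Icc (2 : ℕ) 7,
      ∀ u : ℤ × ℤ × ℤ → E3, (Function.support u).Finite →
        -(ν k * ∑ j ∈ Finset.range k, slabStretchS a h s (m + j) u) ≤ farPairForm a h s m k u) ∧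
  (∀ a h : ℝ, InBox a h →
    (∀ k : ℕ, 2 ≤ k → DifferentiableAt ℝ (fun η : ℝ => barlowCoupling lennardJones a η k) h) ∧
    Summable (fun k : ℕ => |deriv (fun η : ℝ => barlowCoupling lennardJones a η k) h|) ∧
    (∑' k : ℕ, (if 2 ≤ k then |deriv (fun η : ℝ => barlowCoupling lennardJones a η k) h| else 0)) ≤
      φ₀ * |barlowCoupling lennardJones a h 2|)

/-- **HaggCurrent — Hägg domination as a bounded shift-covariant CURRENT** (selection, deterministic,
word-level; the letter-twin of the elastic storage `p`): for every cell in `B₁`, with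
`J_k = barlowCoupling lennardJones a h k`, there is a bounded transfer `t s m` (stacking energy handed from
layer `m − 1` to layer `m`), covariant under the layer shift, such that at EVERY layer of EVERY Hägg word
`Σ_{k ≥ 2 even} J_k + (|J₂|/2)·1[s(m+1) = s(m)] ≤ haggLocalEnergy J s m + t s (m+1) − t s m`
— the hcp value plus the fault price is dominated pointwise up to a telescoping current. Construction
(TRIAGE-r1-1/2/3, provable now from 3063's sign + half-domination): charge every bad pair to the first
fault after it; `t s m = sup_{i ≤ m} Σ_{l ∈ [i,m)} (target_l − local_l) ∈ [0, Σ_k k|J_k|]`. -/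
def HaggCurrent : Prop :=
  ∀ a h : ℝ, InBox a h →
    ∃ t : (ℤ → ℤ) → ℤ → ℝ,
      (∃ C : ℝ, ∀ s m, |t s m| ≤ C) ∧
      (∀ (s : ℤ → ℤ) (m : ℤ), t (fun i => s (i + 1)) m = t s (m + 1)) ∧
      ∀ s : ℤ → ℤ, IsHaggSeq s → ∀ m : ℤ,
        (∑' k : ℕ, (if 2 ≤ k ∧ Even k then barlowCoupling lennardJones a h k else 0)) +
            |barlowCoupling lennardJones a h 2| / 2 * (if s (m + 1) = s m then (1 : ℝ) else 0)
          ≤ haggLocalEnergy (barlowCoupling lennardJones a h) s m + t s (m + 1) - t s m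

/-- **Tolerance event**: the configuration's cluster of radius `4` around the root is two-way `t`-matched
with a LINEAR-isometric copy of the ideal hcp cluster `hcpStacking a h ∩ B̄(0,4)` (root ↔ origin; B-sites
are covered since `hcp − b = −hcp`). Radius `4` is the radius of the proved exact-local-rules propagation for
hcp (`ExcessDecayLiouvilleCoarseGrains.stub_exactLocalRules`). -/
def CloseToHcp (a h t : ℝ) (μ : Measure E3) : Prop :=
  ∃ A : E3 ≃ₗᵢ[ℝ] E3,
    (∀ y : E3, μ {y} ≠ 0 → ‖y‖ ≤ 4 → ∃ p ∈ hcpStacking a h, dist y (A p) ≤ t) ∧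
    (∀ p ∈ hcpStacking a h, ‖p‖ ≤ 4 → ∃ y : E3, μ {y} ≠ 0 ∧ dist y (A p) ≤ t)

/-- **MasterInequality — the law-level deliverable of the engine (C⁺ of the idea card, Markov form).**
There are a reference cell `(a⋆, h⋆) ∈ B₁` and `c > 0` such that for EVERY point-stationary LAYERED
probability law (NO minimising hypothesis) and every tolerance `t ∈ (0, 1]`:
`e(hcpPeriodicConfiguration a⋆ h⋆) + c·t²·P(¬ CloseToHcp a⋆ h⋆ t) ≤ E_P[h]`
(outer measure, `toReal`). Content: hcp at its optimal cell is THE minimiser of the linear functional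
`E_P[h]` on layered point-stationary laws (selection: fault density priced at `|J₂|/2 −` slaving; elastic
rigidity: squared misfit priced at the uniform coercivity constant; compressed regions by convexity), in
the quantitative form whose equality case is read by `RigidReadout`. Ceiling on `c`: the fcc Palm law
forces `c ≤ e_fcc,min − e(hcp⋆) ≈ 7.3e-5` at `t = 1` — `c` is tiny by design, only `c > 0` is used. -/
def MasterInequality : Prop :=
  ∃ a h : ℝ, ∃ ha : a ≠ 0, ∃ hh : h ≠ 0, InBox a h ∧ ∃ c : ℝ, 0 < c ∧
    ∀ P : Measure (Measure E3), IsProbabilityMeasure P → PointStationary P → Layered P →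
      ∀ t : ℝ, 0 < t → t ≤ 1 →
        (hcpPeriodicConfiguration ha hh).energyPerParticle lennardJones +
            c * t ^ 2 * (P {μ | ¬ CloseToHcp a h t μ}).toReal ≤ meanRootEnergy P

/-- **S5 as a named obligation — THE ENGINE**: the finite certificates imply the law-level master
inequality, `TransferCertificate (3/2) → FarFieldBudget (7/10) 24 → LjRegistryDomination → HaggCurrent →
MasterInequality`. Budget: `3/2 − 7/10 = 4/5` of nearest-neighbour stretch left for the r⁻⁸ tail beyond
range 6 (`< 1/100`), the cubic Taylor remainders of near bonds at `≤ 2.5 %` strain (`≈ 0.2–0.4`; regions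
compressed beyond that pay `≥ 1e-2` per site by convexity of `V` on `[0.86, 1.10]` and need no certificate),
and the Young terms at fault-adjacent layers (residual force `F ≈ 6.06e-4`, breathing stiffness `≈ 18.9`,
loss `≈ 9.7e-9·(2K+1)` per cubic layer vs fault price `|J₂|/2 = 3.63e-5`, kit j012726 §C / j012751 C). -/
def EngineClosure : Prop :=
  TransferCertificate (3 / 2) → FarFieldBudget (7 / 10) 24 → LjRegistryDomination → HaggCurrent →
    MasterInequality

/-- **S6 as a named obligation — rigid read-out (no energy, no minimality)**: for a cell in `B₁` and a
point-stationary layered probability law all of whose tolerance events `¬ CloseToHcp a h t`, `t ∈ (0,1]`,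
are null, almost surely the configuration IS `count|A(hcpStacking a h)` for a linear isometry `A`.
Route: a.s. `CloseToHcp` at every rational `t` ⇒ exact congruence of the root's radius-4 cluster
(compactness of `O(3)`, finiteness of hard-core clusters) ⇒ the same at EVERY point (Palm transfer
`PalmUnimodularRigidity.ae_forall_map_sub_of_ae`, local finiteness from the shells' `891/1000` hard core)
⇒ global chart by exact local rules for hcp (`stub_exactLocalRules`, radius 4, key rigidity at 5/2) ⇒
`S = A(hcp − p₀) = A'(hcpStacking a h)` (vertex-transitivity up to the point group, `hcpStacking_sub_b_eq_neg`). -/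
def RigidReadout : Prop :=
  ∀ a h : ℝ, InBox a h → ∀ P : Measure (Measure E3), IsProbabilityMeasure P →
    PointStationary P → Layered P →
      (∀ t : ℝ, 0 < t → t ≤ 1 → P {μ | ¬ CloseToHcp a h t μ} = 0) →
      ∀ᵐ μ ∂P, ∃ A : E3 ≃ₗᵢ[ℝ] E3,
        μ = (Measure.count : Measure E3).restrict (A '' hcpStacking a h)

/-! ## Registered stubs (the only sorries of the file) -/

/-- **S1** (size L; certified numerics: one family of symmetry-reduced 6×6 LMIs over the 2-D Brillouin
zone × `B₁` with Lipschitz control, plus the `k∥ → 0` normal form; numerically feasible with zero loss at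
`λ ≈ 1.82 > 3/2`). The load-bearing lever of the line. -/
theorem stub_transferCertificate : TransferCertificate (3 / 2) := by
  sorry

/-- **S2** (size M–L; interval lattice sums for `k = 2…7`, both alignment types, over `B₁`, redistributed
onto the straddled slabs' cross bonds; and the `h`-derivatives of the Bessel / direct layer sums of 3063). -/
theorem stub_farFieldBudget : FarFieldBudget (7 / 10) 24 := by
  sorry

/-- **S3** = shared item stmt-AtomisticToContinuum-3063 `PoissonBesselStacking.LjRegistryDomination` BY NAME
(sign `J₂ < 0` and half-domination `Σ_{k≥3}(k−1)|J_k| ≤ |J₂|/2` on the box `0.94 ≤ a ≤ 1`,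
`0.78a ≤ h ≤ 0.85a` ⊇ `B₁`; certified Bessel / lattice-sum numerics, margin ≥ 287). -/
theorem stub_ljRegistryDomination : LjRegistryDomination := by
  sorry

/-- **S4** (size M, provable now: the Peierls count of 0737 written as a value function; TRIAGE-r1-1/2/3
re-derived it by hand). -/
theorem stub_haggCurrent : LjRegistryDomination → HaggCurrent := by
  sorry

/-- **S5 — THE ENGINE, hardest stub** (size XL): law-level lifting of S1/S2/S3/S4 to `MasterInequality`.
Foreseen `--supports` lemmas (none is an item; the lead cuts them): (E1) `e(hcpPeriodicConfiguration a h) =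
barlowBaseEnergy + Σ_{k even} J_k` (regrouping of the absolutely convergent lattice sum by layers,
`barlowSiteEnergy_eq`) and the location of the unique non-degenerate minimiser `(a⋆,h⋆)` of `e(hcp ·,·)` in
`B₁` (interval arithmetic on the gradient / Hessian of the layer sums); (E2) the EXACT prestress split of a
pair term about the own-word reference bond `q⋆`: `V(|b|) − V(|q⋆|) = ω_q(|b|² − |q⋆|²) + W̃_q(|b|²)`,
frame-free, with `|b|² − |Rq⋆|² = 2⟨Rq⋆, b − Rq⋆⟩ + |b − Rq⋆|²` for every rotation `R`; (E3) LAW-LEVEL FIRST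
VARIATION: under the Mecke identity the mean labelled bond vector `E[b_q]` is additive along in-plane chart
offsets and along the stationary layer chain (1/6-transport to adjacent-layer neighbours, TRIAGE-r1-1/3), so
`Σ_q ω_q ⟨R q⋆, E b_q − R q⋆⟩ = S:(RᵀG − I) = 0` by ZERO STRESS of the relaxed cell, for every re-rooting-
invariant frame `R`; at fault-adjacent layers the residual force (S2 (ii)) is slaved by Young against the
breathing share of the coercive term; (E4) NEAR FIELD IN EXPECTATION: the slab inequalities of S1 integrated
against the in-plane spectral measure of the increment field of each pair of adjacent layers, the storage
telescoped along the layer chain after an infrared cut-off `|k∥| ≥ ε` and averaging over `M → ∞` layers, then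
`ε → 0`; the strut prestress `−|ω₁|·E|b_q − R₀ q⋆|²` is inside the slab forms, the frame `R₀` being the
law-level Friesecke–James–Müller frame of the ergodic component (`E|∇Φ − R₀|² ≤ C·E dist²(∇Φ, SO(3))`);
(E5) FAR FIELD: S2 (i) the same way, or rotation-free through the cable tax of the prestress split;
(E6) anharmonic remainders by secant convexity of `V` on `[0.86, 1.10]` (no third derivative), compressed
regions (`> 2.5 %`) sitewise by convexity; (E7) selection: `E[haggLocal + haggBackward](root) ≥ 2Σ_even J_k +
|J₂|·P(root layer cubic)` from `HaggCurrent` telescoped along the stationary layer chain; (E8) Markov in the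
misfit, mixtures by linearity (ergodic decomposition only inside (E4)'s frame). -/
theorem stub_lawLevelEngine : EngineClosure := by
  sorry

/-- **S6** (size M–L: compactness, Palm transfer, exact local rules; all three ingredients have proved
models in the tree). -/
theorem stub_rigidReadout : RigidReadout := by
  sorry

/-! ## The kernel-checked composition -/

/-- **Pure logic of the line** (no sorry, no stub used): S1 → S2 → S3 → S4 → S5 → S6 → the crux in the
H1-free unbundled form of `crux_iff_without_rooted`. H3 (`E_P[h] ≤ e*`) is spent exactly once, against
`eStar_le (hcpPeriodicConfiguration a⋆ h⋆)`: every tolerance event is null, the read-out gives the a.s.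
structure, and the same sandwich pins `e(hcp a⋆ h⋆) = e*`. -/
theorem composition :
    TransferCertificate (3 / 2) → FarFieldBudget (7 / 10) 24 → LjRegistryDomination →
    (LjRegistryDomination → HaggCurrent) → EngineClosure → RigidReadout →
    ∀ P : Measure (Measure E3), IsProbabilityMeasure P → PointStationary P →
      meanRootEnergy P ≤ eStar → Layered P → ∀ᵐ μ ∂P, IsRelaxedHcp μ := by
  intro hTC hFB hLj hHC hEng hRead P hP h2 h3 h4
  obtain ⟨a, h, ha, hh, hbox, c, hc, hM⟩ := hEng hTC hFB hLj (hHC hLj)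
  have he : eStar ≤ (hcpPeriodicConfiguration ha hh).energyPerParticle lennardJones := eStar_le _
  -- H3 + MasterInequality: every tolerance event is null
  have hnull : ∀ t : ℝ, 0 < t → t ≤ 1 → P {μ | ¬ CloseToHcp a h t μ} = 0 := by
    intro t ht ht1
    have hineq := hM P hP h2 h4 t ht ht1
    have hct : 0 < c * t ^ 2 := by positivity
    have hle : (P {μ | ¬ CloseToHcp a h t μ}).toReal ≤ 0 := by
      by_contra hcon
      have := mul_pos hct (not_le.1 hcon)
      linarith
    have hzero : (P {μ | ¬ CloseToHcp a h t μ}).toReal = 0 :=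
      le_antisymm hle ENNReal.toReal_nonneg
    rcases (ENNReal.toReal_eq_zero_iff _).1 hzero with h0 | htop
    · exact h0
    · exact absurd htop (measure_ne_top P _)
  -- the energy identity e(hcp a⋆ h⋆) = e*
  have hEeq : (hcpPeriodicConfiguration ha hh).energyPerParticle lennardJones = eStar := by
    refine le_antisymm ?_ he
    have h1 := hM P hP h2 h4 1 one_pos le_rfl
    have h0 : 0 ≤ c * (1 : ℝ) ^ 2 * (P {μ | ¬ CloseToHcp a h 1 μ}).toReal := by positivity
    linarith
  -- rigid read-out
  have hae := hRead a h hbox P hP h2 h4 hnull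
  filter_upwards [hae] with μ hμ
  obtain ⟨A, hA⟩ := hμ
  obtain ⟨ha1, ha2, hh1, hh2⟩ := hbox
  exact ⟨a, h, ha, hh, by linarith, by linarith, by linarith, by linarith, A, hEeq, hA⟩

/-- **The line concludes the crux BY NAME.** The six registered stubs fed into `composition` and the landed
Negative lemma `crux_iff_without_rooted` (H1 and `δ` are decoration); no sorry of its own. -/
theorem LayeredLawsSelectHcp_of : LayeredLawsSelectHcp :=
  crux_iff_without_rooted.2
    (composition stub_transferCertificate stub_farFieldBudget stub_ljRegistryDomination stub_haggCurrent
      stub_lawLevelEngine stub_rigidReadout)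

/-! ## Read-backs (sanity, sorry-free) -/

/-- The Negative lemma the line is built around: H3 is load-bearing (fcc Palm law). Imported, not restated. -/
example := @Summit.AtomisticToContinuum.Crystallization.Theorems.LayeredLawsSelectHcp.Negative.FccModel.layeredLawsSelectHcp_false_without_energy

/-- Tolerance events are monotone: a coarser tolerance is easier to meet. -/
theorem closeToHcp_mono {a h t t' : ℝ} (htt' : t ≤ t') {μ : Measure E3} (hμ : CloseToHcp a h t μ) :
    CloseToHcp a h t' μ := by
  obtain ⟨A, h1, h2⟩ := hμ
  refine ⟨A, fun y hy hy4 => ?_, fun p hp hp4 => ?_⟩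
  · obtain ⟨p, hp, hd⟩ := h1 y hy hy4
    exact ⟨p, hp, hd.trans htt'⟩
  · obtain ⟨y, hy, hd⟩ := h2 p hp hp4
    exact ⟨y, hy, hd.trans htt'⟩

/-- `MasterInequality` alone already says: hcp at its optimal cell is below every layered point-stationary
law in mean root energy (drop the tolerance term) — the selection half in one line, and, read on the fcc
Palm law, the negation of the disprover's kill hypothesis. -/
theorem energy_le_of_masterInequality (hM : MasterInequality) :
    ∃ a h : ℝ, ∃ ha : a ≠ 0, ∃ hh : h ≠ 0, InBox a h ∧
      ∀ P : Measure (Measure E3), IsProbabilityMeasure P → PointStationary P → Layered P →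
        (hcpPeriodicConfiguration ha hh).energyPerParticle lennardJones ≤ meanRootEnergy P := by
  obtain ⟨a, h, ha, hh, hbox, c, hc, hM⟩ := hM
  refine ⟨a, h, ha, hh, hbox, fun P hP h2 h4 => ?_⟩
  have h1 := hM P hP h2 h4 1 one_pos le_rfl
  have h0 : 0 ≤ c * (1 : ℝ) ^ 2 * (P {μ | ¬ CloseToHcp a h 1 μ}).toReal := by positivity
  linarith

end Summit.AtomisticToContinuum.Crystallization.Cruxes.LayeredLawsSelectHcp.StackingBlindCoercivityTransfer

end
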